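import Summits.BirchSwinnertonDyer.Rank1Residual.AdditivePotMult.PotMultKatoFirstUnitIndex
import HarnessLib

/-!
# X4(M) ∩ {`ρ̄_{E,p}` onto}, EVERY odd `p`: `μ = 0` from ANY unit coefficient, `rank E(ℚ) ≤ n₀ = λ_an`,
# and the MAIN CONJECTURE at the pair at class level — from the budget `n₀ = B(E,p)` or on MINIMAL
# rows `n₀ = rank E(ℚ)` (cell `b2b-bsdres`, team n1011, seat p07 (gen 3), row T-E3dM = T-E3d F3;
# sequel of `PotMultKatoFirstUnitIndex.lean`)

HONEST FRAMING (cell `b2b-bsdres`, run/shared/lean/b2b/bsd-rank1-residual/, verbatim in every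
file): the goal of the cell is to DELETE the COMBINATION-SHAPED residual classes of the
Birch–Swinnerton-Dyer formula for ALL analytic-rank `≤ 1` elliptic curves over `ℚ` — "full BSD
formula for every rank `≤ 1` curve in class `C`" assembled STRICTLY from published theorems — so
that the rank-`≤ 1` remainder becomes exactly the CONSTRUCTION-SHAPED classes, which are TYPED
(missing-input `Prop`s), NOT attempted. This is not "finishing BSD". Team n1011 (RESIDUAL-MAP §I
N10 / N11 LOWER half and O7 on the (M) rows = X4(M) ∧ surj(p), every odd `p`): research route on
CONSTRUCTION-SHAPED items; labels and marks UNCHANGED; nothing booked; NO Literature fact minted;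
NO definition. Named facts enter as HYPOTHESES only (`hK` = Kato 2004 Thm. 17.4 (3) half-eigenspace
reading `Wuthrich2014.kato_halfEigenCharIdeal_dvd_cyclotomicPrime_of_surjective`; `hmodD` = modular
parametrisation data). A census record (`CensusQ6.Mult[Odd]FirstUnitIndexAt`, census-ctyper1) or
unit-coefficient binder (`Mult[Odd]BranchUnitCoeffCert`, n1011-p06) is CERTIFICATE-EVIDENCE, never a
fact; the budget `BudgetLeLambdaAt` (n1011-p10) is a typed per-curve input (EPW 2006 §3). Debt 0.

## What (the class-level forms of `PotMultKatoFirstUnitIndex.lean` §1)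

* §1 `ClassX4M.mu_eq_zero_of_katoHalf_of_unitCoeffCert[_odd]`: Kato's divisibility + ANY unit
  coefficient of `ϖ·L_p^±(f_{E♭}, ±1, ω^{(p−1)/2}, T)` (p06's binder) ⟹ for every cyclotomic dual datum
  and generator `fE` of `char_Λ X(E/ℚ_∞)`: `X` torsion, `fE` of unit content, `μ(fE) = 0` —
  Greenberg's `μ = 0` expectation for `E[p]` irreducible, per certified pair, `E` ADDITIVE at `p`.
* §2 `ClassX4M.mordellWeilRank_le_of_katoHalf_of_firstUnitIndex[_odd]`: the record at index `n₀` ⟹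
  `rank E(ℚ) ≤ n₀` (`T^{rank} ∣ fE`, unit content, `λ(fE) ≤ n₀`).
* §3 `ClassX4M.mainConjecture_of_katoHalf_of_firstUnitIndex_of_budget[_odd]`: record at index `b` +
  `BudgetLeLambdaAt p W b` ⟹ for every cyclotomic dual datum `X` torsion, `μ(X) = 0`, `λ(X) = b` and
  `char_Λ X = (g)` for some `g` of unit content carrying Kato's analytic generator (`budgetSqueeze`);
  `ClassX4M.minimalPackage_of_katoHalf_of_firstUnitIndex_mordellWeilRank[_odd]`: record at index
  `rank E(ℚ)` ⟹ for every cyclotomic dual datum and generator `fE`: `λ(fE) = rank`, `μ(fE) = 0`,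
  `ord_{T=0} fE = rank`, `[T^{rank}] fE ∈ ℤ_p^×` (iw-1's `Iwasawa.minimal_package`; T-O7KM's certified
  rank-one rows are the case `rank = 1`).

What is NOT claimed: the budget bound (typed, per curve); BSD_p consequences (sequel
`PotMultCongruentPartnerMainConjecture.lean`); non-surjective rows; `p = 2`. Nothing booked.

References: K. Kato, Astérisque 295 (2004) Thm. 17.4 (3) [Kato2004Asterisque]; R. Greenberg, LNM
1716 (1999) §1 Conj. 1.11, §3 Lemma 3.1 [GreenbergLNM1716]; R. Greenberg, V. Vatsal, Invent. Math.
142 (2000) p. 4 [GreenbergVatsal2000]; M. Emerton, R. Pollack, T. Weston, Invent. Math. 163 (2006) §3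
[EmertonPollackWeston2006]; W. Stein, C. Wuthrich, Math. Comp. 82 (2013) §11 [SteinWuthrich2013];
L. Washington, GTM 83 (1997) §7.1, §13.2 [Washington1997].
-/

set_option autoImplicit false

noncomputable section

open scoped Classical MatrixGroups ModularForm NumberField

namespace Summit.BirchSwinnertonDyer.Rank1Residual.AdditivePotMult

open CongruenceSubgroup WeierstrassCurve NumberField Literature.NumberTheory.EllipticCurves
  Literature.NumberTheory.EllipticCurves.ModularForms
  Literature.NumberTheory.EllipticCurves.Rank1Residual
  Literature.NumberTheory.EllipticCurves.Rank1Residual.Typed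
  Literature.NumberTheory.EllipticCurves.GreenbergVatsal2000
  Literature.NumberTheory.GaloisRepresentations
  Summit.BirchSwinnertonDyer.Rank1Residual.Additive
  Summit.BirchSwinnertonDyer.Rank1Residual.Additive.CensusQ6
  Summit.BirchSwinnertonDyer.Rank1Residual.X1.MuLambda
  Summit.BirchSwinnertonDyer.Rank1Residual.X11a
  Summit.BirchSwinnertonDyer.Rank1Residual.X11a.LambdaNorm
  Summit.BirchSwinnertonDyer.Rank1Residual.Iwasawa
  IsDedekindDomain

variable {W : WeierstrassCurve ℚ} [W.IsElliptic] {p : ℕ} [hp : Fact p.Prime]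

/-! ### §1 `μ(X(E/ℚ_∞)) = 0` from ANY unit coefficient -/

/-- **`μ(X(E/ℚ_∞)) = 0` from ANY unit coefficient, `p ≡ 1 (mod 4)`:** Kato's divisibility + n1011-p06's
weaker binder `MultBranchUnitCoeffCert W p` (SOME coefficient of `ϖ·L_p⁺(f_{E♭}, ±1, ω^{(p−1)/2}, T)` is
a unit) ⟹ for every cyclotomic dual datum and generator: `X` torsion, `fE` of unit content,
`μ(fE) = 0` — Greenberg's `μ = 0` expectation for `E[p]` irreducible, per certified pair.
[cite: Kato2004Asterisque, Thm. 17.4 (3) (p. 273)] [cite: GreenbergLNM1716, §1 Conj. 1.11 (μ = 0; context)] -/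
theorem ClassX4M.mu_eq_zero_of_katoHalf_of_unitCoeffCert
    (hK : Wuthrich2014.kato_halfEigenCharIdeal_dvd_cyclotomicPrime_of_surjective)
    (hmodD : nonempty_modularParametrizationData)
    (hX : ClassX4M W p) (hsurj : Surj W p) (hp4 : p % 4 = 1) (hcert : MultBranchUnitCoeffCert W p)
    {κ : ZpExtension ℚ p} {γ : Field.absoluteGaloisGroup ℚ}
    (hκ : κ.IsCyclotomic) (hγ : κ.IsTopGenerator γ) (hγ' : IsCyclotomicVariable p γ)
    (D : W.SelmerDualData κ γ) {fE : IwasawaAlgebra p} (hchar : D.charIdeal = Ideal.span {fE}) :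
    D.IsTorsion ∧ HasUnitContent fE ∧ mu fE = 0 := by
  have hp2 : p ≠ 2 := hX.p_ne_two
  obtain ⟨V, iV, iVm, C, hV, hC⟩ := hX.exists_mult_pStar_twist_model
  haveI : NeZero (V.conductorNorm ℤ) := ⟨(V.conductorNorm_pos_holds).ne'⟩
  obtain ⟨Dm⟩ := hmodD V
  obtain ⟨ϖ, hϖ⟩ := exists_periodRatio_parity (p := p) V Dm
  have hsurjV : ∀ n : ℕ, V.HasSurjectiveModNGaloisRep (p ^ n : ℕ) :=
    (ClassX4M.potMult W p hX).towerSurj_twist_of_surj hp2 hsurj V C hC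
  have heven : Even (p / 2) := ⟨p / 4, by omega⟩
  have hC' : C • V.quadraticTwist (p : ℚ) = W := by
    rw [← pStar_eq_self_of_mod_four_eq_one hp4]; exact hC
  have hϖ' : (ϖ : ℝ) * V.realPeriodRat = plusPeriod Dm.f := by
    rw [if_pos heven] at hϖ; exact hϖ
  by_cases hs : V.HasSplitMultiplicativeReductionAtPrime p
  · obtain ⟨hap, -⟩ := Dm.isNewformOf.cuspCoeff_eq_one_and_sq_of_split hs
    obtain ⟨n, hn⟩ := hcert V C hV hC' Dm.f Dm.isNewformOf 1 (by exact_mod_cast hap) ϖ hϖ'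
    rw [Int.cast_one] at hn
    obtain ⟨hXt, g, hg, -, hunit, hlam⟩ := isTorsion_and_exists_iota_eq_unitContent_of_katoHalf hK
      hp2 V C hC hsurjV hκ hγ hγ' Dm.isNewformOf D _ (Or.inr (Or.inl ⟨hs, rfl⟩)) ϖ hϖ
      (n := n) (by rw [if_pos heven]; exact hn)
    obtain ⟨hfE, hmu, -⟩ := unitContent_and_mu_eq_zero_and_lam_le_of_mem_span (hchar ▸ hg) hunit hlam
    exact ⟨hXt, hfE, hmu⟩
  · obtain ⟨hap, -⟩ := Dm.isNewformOf.cuspCoeff_eq_neg_one_and_dvd_of_nonsplit hV hs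
    obtain ⟨n, hn⟩ := hcert V C hV hC' Dm.f Dm.isNewformOf (-1) (by exact_mod_cast hap) ϖ hϖ'
    rw [Int.cast_neg, Int.cast_one] at hn
    obtain ⟨hXt, g, hg, -, hunit, hlam⟩ := isTorsion_and_exists_iota_eq_unitContent_of_katoHalf hK
      hp2 V C hC hsurjV hκ hγ hγ' Dm.isNewformOf D _ (Or.inr (Or.inr ⟨hV, hs, rfl⟩)) ϖ hϖ
      (n := n) (by rw [if_pos heven]; exact hn)
    obtain ⟨hfE, hmu, -⟩ := unitContent_and_mu_eq_zero_and_lam_le_of_mem_span (hchar ▸ hg) hunit hlam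
    exact ⟨hXt, hfE, hmu⟩

/-- **`μ(X(E/ℚ_∞)) = 0` from ANY unit coefficient, `p ≡ 3 (mod 4)` (`p = 3` included)**, binder
`MultOddBranchUnitCoeffCert W p`. [cite: Kato2004Asterisque, Thm. 17.4 (3) (p. 273)]
[cite: GreenbergLNM1716, §1 Conj. 1.11 (μ = 0; context)] -/
theorem ClassX4M.mu_eq_zero_of_katoHalf_of_unitCoeffCert_odd
    (hK : Wuthrich2014.kato_halfEigenCharIdeal_dvd_cyclotomicPrime_of_surjective)
    (hmodD : nonempty_modularParametrizationData)
    (hX : ClassX4M W p) (hsurj : Surj W p) (hp4 : p % 4 = 3) (hcert : MultOddBranchUnitCoeffCert W p)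
    {κ : ZpExtension ℚ p} {γ : Field.absoluteGaloisGroup ℚ}
    (hκ : κ.IsCyclotomic) (hγ : κ.IsTopGenerator γ) (hγ' : IsCyclotomicVariable p γ)
    (D : W.SelmerDualData κ γ) {fE : IwasawaAlgebra p} (hchar : D.charIdeal = Ideal.span {fE}) :
    D.IsTorsion ∧ HasUnitContent fE ∧ mu fE = 0 := by
  have hp2 : p ≠ 2 := hX.p_ne_two
  obtain ⟨V, iV, iVm, C, hV, hC⟩ := hX.exists_mult_pStar_twist_model
  haveI : NeZero (V.conductorNorm ℤ) := ⟨(V.conductorNorm_pos_holds).ne'⟩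
  obtain ⟨Dm⟩ := hmodD V
  obtain ⟨ϖ, hϖ⟩ := exists_periodRatio_parity (p := p) V Dm
  have hsurjV : ∀ n : ℕ, V.HasSurjectiveModNGaloisRep (p ^ n : ℕ) :=
    (ClassX4M.potMult W p hX).towerSurj_twist_of_surj hp2 hsurj V C hC
  have hodd : ¬ Even (p / 2) := by rw [Nat.not_even_iff_odd]; exact ⟨p / 4, by omega⟩
  have hC' : C • V.quadraticTwist (-(p : ℚ)) = W := by
    rw [← pStar_eq_neg_of_mod_four_eq_three hp4]; exact hC
  have hϖ' : (ϖ : ℝ) * V.imaginaryPeriodRat = minusPeriod Dm.f := by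
    rw [if_neg hodd] at hϖ; exact hϖ
  by_cases hs : V.HasSplitMultiplicativeReductionAtPrime p
  · obtain ⟨hap, -⟩ := Dm.isNewformOf.cuspCoeff_eq_one_and_sq_of_split hs
    obtain ⟨n, hn⟩ := hcert V C hV hC' Dm.f Dm.isNewformOf 1 (by exact_mod_cast hap) ϖ hϖ'
    rw [Int.cast_one] at hn
    obtain ⟨hXt, g, hg, -, hunit, hlam⟩ := isTorsion_and_exists_iota_eq_unitContent_of_katoHalf hK
      hp2 V C hC hsurjV hκ hγ hγ' Dm.isNewformOf D _ (Or.inr (Or.inl ⟨hs, rfl⟩)) ϖ hϖ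
      (n := n) (by rw [if_neg hodd]; exact hn)
    obtain ⟨hfE, hmu, -⟩ := unitContent_and_mu_eq_zero_and_lam_le_of_mem_span (hchar ▸ hg) hunit hlam
    exact ⟨hXt, hfE, hmu⟩
  · obtain ⟨hap, -⟩ := Dm.isNewformOf.cuspCoeff_eq_neg_one_and_dvd_of_nonsplit hV hs
    obtain ⟨n, hn⟩ := hcert V C hV hC' Dm.f Dm.isNewformOf (-1) (by exact_mod_cast hap) ϖ hϖ'
    rw [Int.cast_neg, Int.cast_one] at hn
    obtain ⟨hXt, g, hg, -, hunit, hlam⟩ := isTorsion_and_exists_iota_eq_unitContent_of_katoHalf hK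
      hp2 V C hC hsurjV hκ hγ hγ' Dm.isNewformOf D _ (Or.inr (Or.inr ⟨hV, hs, rfl⟩)) ϖ hϖ
      (n := n) (by rw [if_neg hodd]; exact hn)
    obtain ⟨hfE, hmu, -⟩ := unitContent_and_mu_eq_zero_and_lam_le_of_mem_span (hchar ▸ hg) hunit hlam
    exact ⟨hXt, hfE, hmu⟩

/-! ### §2 `rank E(ℚ) ≤ n₀ = λ_an` -/

/-- **`rank E(ℚ) ≤ n₀ = λ_an` on X4(M) ∩ {`ρ̄` onto}, `p ≡ 1 (mod 4)`, given the record** — the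
parity-free weak BSD inequality read on the branch of the twist: `T^{rank} ∣ fE`
(`Typed.X_pow_mordellWeilRank_dvd_of_charIdeal_eq_span`, any cyclotomic dual datum — one exists,
`exists_isCyclotomic_isTopGenerator_isCyclotomicVariable_holds`, `nonempty_selmerDualData_holds`),
unit content of `fE` and `λ(fE) ≤ n₀` (`Iwasawa.le_lam_of_X_pow_dvd`).
[cite: GreenbergLNM1716, §3 Lemma 3.1 and §1 p. 65] [cite: Kato2004Asterisque, Thm. 17.4 (3) (p. 273)] -/
theorem ClassX4M.mordellWeilRank_le_of_katoHalf_of_firstUnitIndex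
    (hK : Wuthrich2014.kato_halfEigenCharIdeal_dvd_cyclotomicPrime_of_surjective)
    (hmodD : nonempty_modularParametrizationData)
    (hX : ClassX4M W p) (hsurj : Surj W p) (hp4 : p % 4 = 1) {n₀ : ℕ}
    (hrec : MultFirstUnitIndexAt W p n₀) : W.mordellWeilRank ≤ n₀ := by
  obtain ⟨κ, hκ, γ, hγ, hγ'⟩ := exists_isCyclotomic_isTopGenerator_isCyclotomicVariable_holds p
  obtain ⟨D⟩ := W.nonempty_selmerDualData_holds κ γ hγ
  haveI : Module.Finite (IwasawaAlgebra p) D.X := D.module_finite_holds hγ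
  obtain ⟨fE, hchar⟩ := (charIdeal_isPrincipal_holds p D.X).principal
  have hchar' : D.charIdeal = Ideal.span {fE} := hchar
  obtain ⟨hXt, hfE, -, hlam⟩ :=
    hX.mu_zero_and_lam_le_of_katoHalf_of_firstUnitIndex hK hmodD hsurj hp4 hrec hκ hγ hγ' D hchar'
  exact (le_lam_of_X_pow_dvd hfE (X_pow_mordellWeilRank_dvd_of_charIdeal_eq_span W p hγ D hXt hchar')).trans
    hlam

/-- **`rank E(ℚ) ≤ n₀` on X4(M) ∩ {`ρ̄` onto}, `p ≡ 3 (mod 4)` (`p = 3` included), given the record.**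
[cite: GreenbergLNM1716, §3 Lemma 3.1 and §1 p. 65] [cite: Kato2004Asterisque, Thm. 17.4 (3) (p. 273)] -/
theorem ClassX4M.mordellWeilRank_le_of_katoHalf_of_firstUnitIndex_odd
    (hK : Wuthrich2014.kato_halfEigenCharIdeal_dvd_cyclotomicPrime_of_surjective)
    (hmodD : nonempty_modularParametrizationData)
    (hX : ClassX4M W p) (hsurj : Surj W p) (hp4 : p % 4 = 3) {n₀ : ℕ}
    (hrec : MultOddFirstUnitIndexAt W p n₀) : W.mordellWeilRank ≤ n₀ := by
  obtain ⟨κ, hκ, γ, hγ, hγ'⟩ := exists_isCyclotomic_isTopGenerator_isCyclotomicVariable_holds p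
  obtain ⟨D⟩ := W.nonempty_selmerDualData_holds κ γ hγ
  haveI : Module.Finite (IwasawaAlgebra p) D.X := D.module_finite_holds hγ
  obtain ⟨fE, hchar⟩ := (charIdeal_isPrincipal_holds p D.X).principal
  have hchar' : D.charIdeal = Ideal.span {fE} := hchar
  obtain ⟨hXt, hfE, -, hlam⟩ :=
    hX.mu_zero_and_lam_le_of_katoHalf_of_firstUnitIndex_odd hK hmodD hsurj hp4 hrec hκ hγ hγ' D hchar'
  exact (le_lam_of_X_pow_dvd hfE (X_pow_mordellWeilRank_dvd_of_charIdeal_eq_span W p hγ D hXt hchar')).trans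
    hlam

/-! ### §3 The main conjecture at the pair, class level -/

/-- **X4(M) ∩ {`ρ̄` onto}, `p ≡ 1 (mod 4)`: record at index `b` + budget `BudgetLeLambdaAt p W b` ⟹
the MAIN CONJECTURE at the pair** — for EVERY cyclotomic dual datum: `X(E/ℚ_∞)` torsion, `μ(X) = 0`,
`λ(X) = b`, and `char_Λ X(E/ℚ_∞) = (g)` for an element `g` of unit content (the one carrying Kato's
analytic generator `u·ϖ·L_p⁺(f_{E♭}, ±1, ω^{(p−1)/2}, T)` of the chosen twist datum; data-level form with
the series explicit: `charIdeal_eq_span_of_katoHalf_of_norm_coeff_of_budget`). n1011-p10's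
`budgetSqueeze` on §2 of the prequel. [cite: Kato2004Asterisque, Thm. 17.4 (3) (p. 273)]
[cite: EmertonPollackWeston2006, Cor. 3.2.5 and Thm. 3.1.1 (source of the typed input)] [cite: Washington1997, §13.2] -/
theorem ClassX4M.mainConjecture_of_katoHalf_of_firstUnitIndex_of_budget [W.IsGloballyMinimal]
    (hK : Wuthrich2014.kato_halfEigenCharIdeal_dvd_cyclotomicPrime_of_surjective)
    (hmodD : nonempty_modularParametrizationData)
    (hX : ClassX4M W p) (hsurj : Surj W p) (hp4 : p % 4 = 1) {b : ℕ}
    (hrec : MultFirstUnitIndexAt W p b) (hbud : BudgetLeLambdaAt p W b)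
    {κ : ZpExtension ℚ p} {γ : Field.absoluteGaloisGroup ℚ}
    (hκ : κ.IsCyclotomic) (hγ : κ.IsTopGenerator γ) (hγ' : IsCyclotomicVariable p γ)
    (D : W.SelmerDualData κ γ) :
    D.IsTorsion ∧ D.mu = 0 ∧ lambdaInvariant p D.X = b ∧
      ∃ g : IwasawaAlgebra p, D.charIdeal = Ideal.span {g} ∧ HasUnitContent g := by
  obtain ⟨hXt, g, hg, hunit, hlam⟩ :=
    hX.isTorsion_and_exists_unitContent_lam_le_of_katoHalf_of_firstUnitIndex hK hmodD hsurj hp4 hrec hκ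
      hγ hγ' D
  haveI : Module.Finite (IwasawaAlgebra p) D.X := D.module_finite_holds hγ
  obtain ⟨fE, hchar, -⟩ := exists_charIdeal_eq_span_singleton p D
  have hdvd : fE ∣ g := Ideal.mem_span_singleton.mp (hchar ▸ hg)
  obtain ⟨hspan, hmu, hlamD⟩ := budgetSqueeze p W hbud hκ hγ hγ' D hXt hchar hunit hdvd hlam
  exact ⟨hXt, hmu, hlamD, g, hchar.trans hspan.symm, hunit⟩

/-- **X4(M) ∩ {`ρ̄` onto}, `p ≡ 3 (mod 4)` (`p = 3` included): record at index `b` + budget ⟹ the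
main conjecture at the pair** (`μ(X) = 0`, `λ(X) = b`, `char = (g)` with `g` of unit content).
[cite: Kato2004Asterisque, Thm. 17.4 (3) (p. 273)] [cite: EmertonPollackWeston2006, Cor. 3.2.5 and Thm. 3.1.1 (source of the typed input)]
[cite: Washington1997, §13.2] -/
theorem ClassX4M.mainConjecture_of_katoHalf_of_firstUnitIndex_of_budget_odd [W.IsGloballyMinimal]
    (hK : Wuthrich2014.kato_halfEigenCharIdeal_dvd_cyclotomicPrime_of_surjective)
    (hmodD : nonempty_modularParametrizationData)
    (hX : ClassX4M W p) (hsurj : Surj W p) (hp4 : p % 4 = 3) {b : ℕ}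
    (hrec : MultOddFirstUnitIndexAt W p b) (hbud : BudgetLeLambdaAt p W b)
    {κ : ZpExtension ℚ p} {γ : Field.absoluteGaloisGroup ℚ}
    (hκ : κ.IsCyclotomic) (hγ : κ.IsTopGenerator γ) (hγ' : IsCyclotomicVariable p γ)
    (D : W.SelmerDualData κ γ) :
    D.IsTorsion ∧ D.mu = 0 ∧ lambdaInvariant p D.X = b ∧
      ∃ g : IwasawaAlgebra p, D.charIdeal = Ideal.span {g} ∧ HasUnitContent g := by
  obtain ⟨hXt, g, hg, hunit, hlam⟩ :=
    hX.isTorsion_and_exists_unitContent_lam_le_of_katoHalf_of_firstUnitIndex_odd hK hmodD hsurj hp4 hrec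
      hκ hγ hγ' D
  haveI : Module.Finite (IwasawaAlgebra p) D.X := D.module_finite_holds hγ
  obtain ⟨fE, hchar, -⟩ := exists_charIdeal_eq_span_singleton p D
  have hdvd : fE ∣ g := Ideal.mem_span_singleton.mp (hchar ▸ hg)
  obtain ⟨hspan, hmu, hlamD⟩ := budgetSqueeze p W hbud hκ hγ hγ' D hXt hchar hunit hdvd hlam
  exact ⟨hXt, hmu, hlamD, g, hchar.trans hspan.symm, hunit⟩

/-- **MINIMAL (M) ROWS, `p ≡ 1 (mod 4)`: a record at index `rank E(ℚ)` gives the main conjecture at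
the pair with NO lower input** — for EVERY cyclotomic dual datum and EVERY generator `fE` of
`char_Λ X(E/ℚ_∞)`: `X` torsion, `λ(fE) = rank E(ℚ)`, `μ(fE) = 0`, `ord_{T=0} fE = rank E(ℚ)` and
`[T^{rank}] fE ∈ ℤ_p^×` (`T^{rank} ∣ fE` + iw-1's `Iwasawa.minimal_package`; T-O7KM's certified
rank-one rows are the case `rank = 1`, where this is the `ord_{T=0} fE = 1 ∧ unit leading
coefficient` behind its Schneider/BSD identity). [cite: GreenbergLNM1716, §3 Lemma 3.1 (T^{rank} ∣ char)]
[cite: SteinWuthrich2013, §11 remark (p. 29)] [cite: Kato2004Asterisque, Thm. 17.4 (3) (p. 273)] -/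
theorem ClassX4M.minimalPackage_of_katoHalf_of_firstUnitIndex_mordellWeilRank
    (hK : Wuthrich2014.kato_halfEigenCharIdeal_dvd_cyclotomicPrime_of_surjective)
    (hmodD : nonempty_modularParametrizationData)
    (hX : ClassX4M W p) (hsurj : Surj W p) (hp4 : p % 4 = 1)
    (hrec : MultFirstUnitIndexAt W p W.mordellWeilRank)
    {κ : ZpExtension ℚ p} {γ : Field.absoluteGaloisGroup ℚ}
    (hκ : κ.IsCyclotomic) (hγ : κ.IsTopGenerator γ) (hγ' : IsCyclotomicVariable p γ)
    (D : W.SelmerDualData κ γ) {fE : IwasawaAlgebra p} (hchar : D.charIdeal = Ideal.span {fE}) :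
    D.IsTorsion ∧ lam fE = W.mordellWeilRank ∧ mu fE = 0 ∧ fE.order = W.mordellWeilRank ∧
      IsUnit (PowerSeries.coeff W.mordellWeilRank fE) := by
  obtain ⟨hXt, g, hg, hunit, hlam⟩ :=
    hX.isTorsion_and_exists_unitContent_lam_le_of_katoHalf_of_firstUnitIndex hK hmodD hsurj hp4 hrec hκ
      hγ hγ' D
  haveI : Module.Finite (IwasawaAlgebra p) D.X := D.module_finite_holds hγ
  have hdvd : fE ∣ g := Ideal.mem_span_singleton.mp (hchar ▸ hg)
  obtain ⟨-, hlamfE, -, hmufE, -, hord, hcoeff⟩ := minimal_package hunit hdvd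
    (X_pow_mordellWeilRank_dvd_of_charIdeal_eq_span W p hγ D hXt hchar) hlam
  exact ⟨hXt, hlamfE, hmufE, hord, hcoeff⟩

/-- **MINIMAL (M) ROWS, `p ≡ 3 (mod 4)` (`p = 3` included): record at index `rank E(ℚ)` ⟹ for every
cyclotomic dual datum and generator `fE`: `λ(fE) = rank`, `μ(fE) = 0`, `ord_{T=0} fE = rank`,
`[T^{rank}] fE ∈ ℤ_p^×`.** [cite: GreenbergLNM1716, §3 Lemma 3.1 (T^{rank} ∣ char)]
[cite: SteinWuthrich2013, §11 remark (p. 29)] [cite: Kato2004Asterisque, Thm. 17.4 (3) (p. 273)] -/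
theorem ClassX4M.minimalPackage_of_katoHalf_of_firstUnitIndex_mordellWeilRank_odd
    (hK : Wuthrich2014.kato_halfEigenCharIdeal_dvd_cyclotomicPrime_of_surjective)
    (hmodD : nonempty_modularParametrizationData)
    (hX : ClassX4M W p) (hsurj : Surj W p) (hp4 : p % 4 = 3)
    (hrec : MultOddFirstUnitIndexAt W p W.mordellWeilRank)
    {κ : ZpExtension ℚ p} {γ : Field.absoluteGaloisGroup ℚ}
    (hκ : κ.IsCyclotomic) (hγ : κ.IsTopGenerator γ) (hγ' : IsCyclotomicVariable p γ)
    (D : W.SelmerDualData κ γ) {fE : IwasawaAlgebra p} (hchar : D.charIdeal = Ideal.span {fE}) :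
    D.IsTorsion ∧ lam fE = W.mordellWeilRank ∧ mu fE = 0 ∧ fE.order = W.mordellWeilRank ∧
      IsUnit (PowerSeries.coeff W.mordellWeilRank fE) := by
  obtain ⟨hXt, g, hg, hunit, hlam⟩ :=
    hX.isTorsion_and_exists_unitContent_lam_le_of_katoHalf_of_firstUnitIndex_odd hK hmodD hsurj hp4 hrec
      hκ hγ hγ' D
  haveI : Module.Finite (IwasawaAlgebra p) D.X := D.module_finite_holds hγ
  have hdvd : fE ∣ g := Ideal.mem_span_singleton.mp (hchar ▸ hg)
  obtain ⟨-, hlamfE, -, hmufE, -, hord, hcoeff⟩ := minimal_package hunit hdvd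
    (X_pow_mordellWeilRank_dvd_of_charIdeal_eq_span W p hγ D hXt hchar) hlam
  exact ⟨hXt, hlamfE, hmufE, hord, hcoeff⟩

end Summit.BirchSwinnertonDyer.Rank1Residual.AdditivePotMult

end
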